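/-
Copyright: the b2b-balaban cell (near-miss cell 7), T⁴-continuum fan-out; row NE7b ROUND-2 swarm, seat
t4-ne7b-formalise-leaf-05 gen 10 (row S12o «CONCAVE ENTROPY REPAIR» of `t4/b2b-balaban-t4-ne7b-p1/LEAVES-NE7b.md`, part
(ii) «THE WIRING», file 2∕4; owner's ruling R-OWNER-23-15 and division of labour, journal l.17861 ∕ l.17953; CLAIM
l.17968).  Released under the licence of the surrounding project.
-/
import Summits.QuantumFields.BalabanUV.T4Continuum.Support.HistoryJoinsEndConcave
import Summits.QuantumFields.BalabanUV.T4Continuum.Support.HistoryJoinsPlacedEnd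

/-!
# The concave END with the cardinality majorant and the locality radius BY SUPREMUM, for ANY nearness kit
# (row S12o part (ii), file 2∕4 — the sup form of part 8′)

Summits-side support leaf of the T⁴-continuum cell (rung (B)+1 on a FINITE torus only; NOT infinite volume, NOT the
mass gap, NOT the Clay statement; NOT a proof of the spine estimate NE7b).  Row NE7b, route «COUNT»; smallness-census
rows S12n ∕ S12o.  SIBLING of leaf-02 gen 4's `HistoryJoinsSupEnd.card_S_le_exp_pow_sup_slack` and of gen 3's
`HistoryJoinsPlacedEnd.card_S_le_exp_pow_placed` §2, over part 8′ (`HistoryJoinsEndConcave.card_S_le_exp_pow_slack'`,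
this seat, file 1∕4): `hcard` ∕ `hloc` DISCHARGED by `Msup` ∕ `extsup` (`HistoryJoinsSup`), the mass input by the
per-placement cardinality law in `zmass` currency (`MS_sup_le_bsum`), the pivot `κM := (WB+WM)∕(1−θ) + 2γ′`.  The
NEARNESS KIT — relation `near`, witness radius `rad`, one-block count `NZ`, radius factor `Mρ` with their five facts —
and the radius-product input `hMρP : MρP ≤ exp(κρ·F)` stay ABSTRACT here: row S12o (i-c) (leaf-10 g12's
`HistoryJoinsPlacedOmega`: the scaled kit `nearPΩ` ∕ `radPΩ` ∕ `NZPΩ′` ∕ `MρPΩ′` and the concave product bound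
`MρP_placedΩ_le_exp`) is plugged in file 3∕4, gen 3's kit `nearP` ∕ `radP` ∕ `NZP'` ∕ `MρP'` with `MρP_placed_le_exp` fits as
well.  [folklore] composition BY NAME; nothing is quoted from print, nothing printed is asserted, no `[cite:]` tag, no
`Prop` fact, no definition, no constant of print; no landed file is edited; no END of record ∕ exit ∕ socket ∕
`HistoryConstants*` file is touched (c3).

WHAT.
* **`card_S_le_exp_pow_kit'`** — for every shape tree `G` read by `st := PEv.step ∘ sh`, dated and chronological, every
  root datum `z`: `#S zone ρ c₀ st G z ≤ exp((1 + log κM + κρ + κE)·F + Ξ)·(Λ·e^{μE})^{partnerAges st G}`,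
  `κM = (WB+WM)∕(1−θ) + 2γ′`, under: the kit's facts (`hmono`, the reading fact `hnearW` at the witness radius, `hNZ`,
  `hMρ0`, `hNZle`), the per-placement cardinality law at the joins (`hlawM`), `1 ≤ κM`, the abstract radius-product
  input `hMρP` on `ext := extsup … rad`, and the entropy input with slack `Ξ`;
* `card_S_le_exp_pow_kit'_noSlack` — the same at `Ξ = 0`;
* `one_le_kappaM` — `1 ≤ (WB+WM)∕(1−θ) + 2γ′` from `0 ≤ WB`, `0 ≤ WM`, `θ < 1`, `1∕2 ≤ γ′` (the instance has `γ′ = 2A ≥ 2`);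
* §2 CONTROL **`card_S_le_exp_pow_placed'`** — gen 3's `card_S_le_exp_pow_placed` (kit `nearP` ∕ `radP` ∕ `NZP'` ∕ `MρP'`,
  radius side `MρP_placed_le_exp` unchanged) with the pivot only: binders + `hκM`, mass exponent `2 + κM ↦ 1 + log κM`.

HONEST SCOPE.  Bookkeeping END for OUR count; displayed = the kit's five facts + `hlawM` + `hMρP` + `hENT` + `Dated` ∕
`Chrono` + signs + `1 ≤ κM`, each with a named supplier downstream; the headline's Prop (p224237) is unchanged by any
of this.  NE7b NOT proved; spine 0∕9.  HONEST DEPENDENCY (cell): continuum YM on T⁴ ⇐ BetaPertH ∧ nine spine estimates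
(0/9 proved); BetaPertH ⇐ (D1) ∧ (D4) ∧ CAP+tail; G-an2-4 gates asym, D1 and NE2/3/4.  This file changes none of it.
-/

open Finset
open Literature.MathematicalPhysics.QuantumFieldTheory.Balaban1983to89
open T4PersistenceDictionary T4PartnerMultiplicity T4BranchingRecordsGas
open Summit.QuantumFields.BalabanUV.T4Continuum.HistoryJoins
open Summit.QuantumFields.BalabanUV.T4Continuum.HistoryJoinsAdm
open Summit.QuantumFields.BalabanUV.T4Continuum.HistoryJoinsBudget
open Summit.QuantumFields.BalabanUV.T4Continuum.HistoryJoinsEntropyBudget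
open Summit.QuantumFields.BalabanUV.T4Continuum.HistoryJoinsEnd
open Summit.QuantumFields.BalabanUV.T4Continuum.HistoryJoinsEndConcave
open Summit.QuantumFields.BalabanUV.T4Continuum.HistoryJoinsSup
open Summit.QuantumFields.BalabanUV.T4Continuum.ZoneTorus
open Summit.QuantumFields.BalabanUV.T4Continuum.ZoneSkeleton
open Summit.QuantumFields.BalabanUV.T4Continuum.HistoryZones
open Summit.QuantumFields.BalabanUV.T4Continuum.HistoryZoneMass
open Summit.QuantumFields.BalabanUV.T4Continuum.HistoryMassPlacement
open Summit.QuantumFields.BalabanUV.T4Continuum.HistoryJoinsSupTorus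
open Summit.QuantumFields.BalabanUV.T4Continuum.HistoryJoinsPlaced
open Summit.QuantumFields.BalabanUV.T4Continuum.HistoryJoinsRadius
open Summit.QuantumFields.BalabanUV.T4Continuum.HistoryJoinsNonhost
open Summit.QuantumFields.BalabanUV.T4Continuum.HistoryJoinsPlacedEnd
open Summit.QuantumFields.BalabanUV.T4Continuum.HistoryZoneMassJoins
open Summit.QuantumFields.BalabanUV.T4Continuum.HistoryZoneMassLaw
open Summit.QuantumFields.BalabanUV.T4Continuum.HistoryZoneMassTotal

namespace Summit.QuantumFields.BalabanUV.T4Continuum.HistoryJoinsPlacedEndConcave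

noncomputable section

open scoped Classical

/-! ## §0 The pivot is at least one -/

/-- `1 ≤ (WB+WM)∕(1−θ) + 2γ′` once `γ′ ≥ 1∕2` (signs as in the END). [folklore] -/
theorem one_le_kappaM {θ WB WM γ' : ℝ} (hθ1 : θ < 1) (hB : 0 ≤ WB) (hM : 0 ≤ WM) (hγ : 1 / 2 ≤ γ') :
    1 ≤ (WB + WM) / (1 - θ) + 2 * γ' := by
  have : 0 ≤ (WB + WM) / (1 - θ) := div_nonneg (add_nonneg hB hM) (by linarith)
  linarith

/-! ## §1 The concave END for an abstract nearness kit, majorants by supremum -/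

section Kit

variable {ε γ β R : Type*} [DecidableEq β] [LinearOrder R] [Fintype γ] {D : ℕ} [DecidableEq ε] (sh : ε → PEv)
  (zone : ℕ → Gen ε → (Addr D → γ) → Finset β) (ρ : (Addr D → γ) → R) (c₀ : γ)
  (near : β → ℕ → γ → ℕ → ℝ → Prop) (rad : β → ℕ → γ → ℕ → ℝ) (NZ : ℝ → ℕ → ℕ → ℕ) (Mρ : ℝ → ℝ)

/-- **ROW S12o (ii) — THE CONCAVE END FOR AN ABSTRACT NEARNESS KIT** (`M := Msup`, `ext := extsup … rad`,
pivot `κM := (WB+WM)∕(1−θ) + 2γ′`):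
`#S zone ρ c₀ st G z ≤ exp((1 + log κM + κρ + κE)·F + Ξ)·(Λ·e^{μE})^{partnerAges st G}`. [folklore] -/
theorem card_S_le_exp_pow_kit'
    (hmono : ∀ u t y s (r r' : ℝ), near u t y s r → r ≤ r' → near u t y s r')
    (hnearW : ∀ (t : ℕ) (Z : Gen ε) (p : Addr D → γ) (u : β), p ∈ Sany zone ρ c₀ (PEv.step ∘ sh) Z →
      u ∈ zone t Z p → near u t (evalA c₀ p (rootAddr Z)) Z.rootStep (rad u t (evalA c₀ p (rootAddr Z)) Z.rootStep))
    (hNZ : ∀ (u : β) (t s : ℕ) (r : ℝ), (univ.filter fun y : γ => near u t y s r).card ≤ NZ r t s)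
    {Λ : ℝ} (hΛ : 0 ≤ Λ) (hMρ0 : ∀ r, 0 ≤ Mρ r)
    (hNZle : ∀ (r : ℝ) (t s : ℕ), (NZ r t s : ℝ) ≤ Mρ r * Λ ^ (t + 1 - s))
    {θ WB WM γ' : ℝ} (hθ0 : 0 ≤ θ) (hθ1 : θ < 1) (hB : 0 ≤ WB) (hM : 0 ≤ WM) (hγ : 0 ≤ γ')
    (hκM : 1 ≤ (WB + WM) / (1 - θ) + 2 * γ')
    {G : Gen ε} {T : ℕ} (hDt : Dated (PEv.step ∘ sh) true T G) (hCh : Chrono (PEv.step ∘ sh) G)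
    (hlawM : ∀ X ∈ joins (PEv.step ∘ sh) G, ∀ P ∈ tparts (PEv.step ∘ sh) X,
      ∀ p ∈ Sany zone ρ c₀ (PEv.step ∘ sh) P,
        ((zone (ftime (PEv.step ∘ sh) X) P p).card : ℝ) ≤ zmass sh θ WB WM (ftime (PEv.step ∘ sh) X) P + γ')
    {κρ : ℝ}
    (hMρP : MρP (PEv.step ∘ sh) (extsup zone ρ c₀ (PEv.step ∘ sh) rad) Mρ G ≤
      Real.exp (κρ * bsum (fun b => (((sh b).fat : ℕ) : ℝ) + 1) G))
    {κE μE Ξ : ℝ}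
    (hENT : ENT (PEv.step ∘ sh) G ≤
      κE * bsum (fun b => (((sh b).fat : ℕ) : ℝ) + 1) G + μE * partnerAges (PEv.step ∘ sh) G + Ξ)
    (z : γ) :
    ((S zone ρ c₀ (PEv.step ∘ sh) G z).card : ℝ) ≤
      Real.exp ((1 + Real.log ((WB + WM) / (1 - θ) + 2 * γ') + κρ + κE) *
          bsum (fun b => (((sh b).fat : ℕ) : ℝ) + 1) G + Ξ) *
        (Λ * Real.exp μE) ^ partnerAges (PEv.step ∘ sh) G :=
  card_S_le_exp_pow_slack' (PEv.step ∘ sh) (Msup zone ρ c₀ (PEv.step ∘ sh))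
    (extsup zone ρ c₀ (PEv.step ∘ sh) rad) NZ Mρ zone ρ c₀ near
    (fun t Z _ hp => card_zone_le_Msup zone ρ c₀ (PEv.step ∘ sh) t Z hp)
    (fun t Z p u hp hu => near_extsup zone ρ c₀ (PEv.step ∘ sh) rad near hmono hnearW t Z p u hp hu) hNZ hΛ hMρ0 hNZle
    (fun b => (sh b).fat) G hκM (MS_sup_le_bsum zone ρ c₀ sh hθ0 hθ1 hB hM hγ hDt hCh hlawM) hMρP hENT z

/-- the same without slack [folklore] -/
theorem card_S_le_exp_pow_kit'_noSlack
    (hmono : ∀ u t y s (r r' : ℝ), near u t y s r → r ≤ r' → near u t y s r')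
    (hnearW : ∀ (t : ℕ) (Z : Gen ε) (p : Addr D → γ) (u : β), p ∈ Sany zone ρ c₀ (PEv.step ∘ sh) Z →
      u ∈ zone t Z p → near u t (evalA c₀ p (rootAddr Z)) Z.rootStep (rad u t (evalA c₀ p (rootAddr Z)) Z.rootStep))
    (hNZ : ∀ (u : β) (t s : ℕ) (r : ℝ), (univ.filter fun y : γ => near u t y s r).card ≤ NZ r t s)
    {Λ : ℝ} (hΛ : 0 ≤ Λ) (hMρ0 : ∀ r, 0 ≤ Mρ r)
    (hNZle : ∀ (r : ℝ) (t s : ℕ), (NZ r t s : ℝ) ≤ Mρ r * Λ ^ (t + 1 - s))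
    {θ WB WM γ' : ℝ} (hθ0 : 0 ≤ θ) (hθ1 : θ < 1) (hB : 0 ≤ WB) (hM : 0 ≤ WM) (hγ : 0 ≤ γ')
    (hκM : 1 ≤ (WB + WM) / (1 - θ) + 2 * γ')
    {G : Gen ε} {T : ℕ} (hDt : Dated (PEv.step ∘ sh) true T G) (hCh : Chrono (PEv.step ∘ sh) G)
    (hlawM : ∀ X ∈ joins (PEv.step ∘ sh) G, ∀ P ∈ tparts (PEv.step ∘ sh) X,
      ∀ p ∈ Sany zone ρ c₀ (PEv.step ∘ sh) P,
        ((zone (ftime (PEv.step ∘ sh) X) P p).card : ℝ) ≤ zmass sh θ WB WM (ftime (PEv.step ∘ sh) X) P + γ')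
    {κρ : ℝ}
    (hMρP : MρP (PEv.step ∘ sh) (extsup zone ρ c₀ (PEv.step ∘ sh) rad) Mρ G ≤
      Real.exp (κρ * bsum (fun b => (((sh b).fat : ℕ) : ℝ) + 1) G))
    {κE μE : ℝ}
    (hENT : ENT (PEv.step ∘ sh) G ≤
      κE * bsum (fun b => (((sh b).fat : ℕ) : ℝ) + 1) G + μE * partnerAges (PEv.step ∘ sh) G)
    (z : γ) :
    ((S zone ρ c₀ (PEv.step ∘ sh) G z).card : ℝ) ≤
      Real.exp ((1 + Real.log ((WB + WM) / (1 - θ) + 2 * γ') + κρ + κE) *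
          bsum (fun b => (((sh b).fat : ℕ) : ℝ) + 1) G) *
        (Λ * Real.exp μE) ^ partnerAges (PEv.step ∘ sh) G := by
  have h := card_S_le_exp_pow_kit' sh zone ρ c₀ near rad NZ Mρ hmono hnearW hNZ hΛ hMρ0 hNZle hθ0 hθ1 hB hM hγ hκM
    hDt hCh hlawM hMρP (Ξ := 0) (by rw [add_zero]; exact hENT) z
  rwa [add_zero] at h

end Kit

/-! ## §2 Control: gen 3's kit `nearP` ∕ `radP` ∕ `NZP'` ∕ `MρP'` — the placed END with the pivot only -/

section Placed

variable {ε R Tm : Type*} [DecidableEq ε] [LinearOrder R] [Fintype Tm] {d n L K D : ℕ} (sh : ε → PEv)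
  (lv : ℕ → ℕ) (tsz : Tm → ℕ)
  (zone : ℕ → Gen ε → (Addr D → TCell d (n * L ^ K) × Tm) → Finset (Fin d → ℕ))
  (ρ : (Addr D → TCell d (n * L ^ K) × Tm) → R) (c₀ : TCell d (n * L ^ K) × Tm)

/-- **CONTROL — gen 3's `HistoryJoinsPlacedEnd.card_S_le_exp_pow_placed` WITH THE PIVOT ONLY**: the same binders plus
`hκM`, the same radius side (`MρP_placed_le_exp`, pointwise-linearised `κρ`), the mass exponent `2 + κM ↦ 1 + log κM`.
(The kit END at `nearP` ∕ `radP` ∕ `NZP'` ∕ `MρP'`; the full repair replaces this radius side in file 3∕4.) [folklore] -/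
theorem card_S_le_exp_pow_placed' (hL : 1 ≤ L) (hlv : HistoryZones.LevelFn K lv)
    (hzoneW : ∀ (t : ℕ) (Z : Gen ε) (p : Addr D → TCell d (n * L ^ K) × Tm) (u : Fin d → ℕ),
      p ∈ Sany zone ρ c₀ (PEv.step ∘ sh) Z → u ∈ zone t Z p →
        lv t ≤ K ∧ IsScale L (lv Z.rootStep) (evalA c₀ p (rootAddr Z)).1 ∧ ∀ i, u i < n * L ^ (K - lv t))
    {A : ℕ → ℕ} (hA : ∀ m : ℕ, ((univ : Finset Tm).filter fun T => tsz T ≤ m).card ≤ A m)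
    {a₁ d₁ : ℝ} (ha : 0 ≤ a₁) (hd : 0 ≤ d₁) (hAexp : ∀ m : ℕ, (A m : ℝ) ≤ Real.exp (a₁ + d₁ * m))
    {θ WB WM γ' C₀ c₉ κφ : ℝ} (hθ0 : 0 ≤ θ) (hθ1 : θ < 1) (hB : 0 ≤ WB) (hM : 0 ≤ WM) (hγ : 0 ≤ γ')
    (hκM : 1 ≤ (WB + WM) / (1 - θ) + 2 * γ') (hC₀ : 0 ≤ C₀) (hc₉ : 0 ≤ c₉)
    {G : Gen ε} {T : ℕ} (hDt : Dated (PEv.step ∘ sh) true T G) (hCh : Chrono (PEv.step ∘ sh) G)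
    (hlawM : ∀ X ∈ joins (PEv.step ∘ sh) G, ∀ P ∈ tparts (PEv.step ∘ sh) X,
      ∀ p ∈ Sany zone ρ c₀ (PEv.step ∘ sh) P,
        ((zone (ftime (PEv.step ∘ sh) X) P p).card : ℝ) ≤ zmass sh θ WB WM (ftime (PEv.step ∘ sh) X) P + γ')
    (φ : ℕ → Gen ε → ℝ) (hφ0 : ∀ t P, 0 ≤ φ t P)
    (hlawR : ∀ (X Y : Gen ε) (e : ε), Gen.merge X Y e ∈ joins (PEv.step ∘ sh) G →
      ∀ i, i ≠ hostIdx (PEv.step ∘ sh) X Y e →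
        ∀ p ∈ Sany zone ρ c₀ (PEv.step ∘ sh) (part (PEv.step ∘ sh) (Gen.merge X Y e) i).2,
          ∀ u ∈ zone (sh e).step (part (PEv.step ∘ sh) (Gen.merge X Y e) i).2 p,
            radP n L K lv tsz u (sh e).step (evalA c₀ p (rootAddr (part (PEv.step ∘ sh) (Gen.merge X Y e) i).2))
                (part (PEv.step ∘ sh) (Gen.merge X Y e) i).2.rootStep ≤
              C₀ * φ (sh e).step (part (PEv.step ∘ sh) (Gen.merge X Y e) i).2 + c₉)
    (hΦ : ((joins (PEv.step ∘ sh) G).map fun X => nhsum (PEv.step ∘ sh) (φ (ftime (PEv.step ∘ sh) X)) X).sum ≤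
      κφ * bsum (fun b => (((sh b).fat : ℕ) : ℝ) + 1) G)
    {κE μE Ξ : ℝ}
    (hENT : ENT (PEv.step ∘ sh) G ≤
      κE * bsum (fun b => (((sh b).fat : ℕ) : ℝ) + 1) G + μE * partnerAges (PEv.step ∘ sh) G + Ξ)
    (z : TCell d (n * L ^ K) × Tm) :
    ((S zone ρ c₀ (PEv.step ∘ sh) G z).card : ℝ) ≤
      Real.exp ((1 + Real.log ((WB + WM) / (1 - θ) + 2 * γ') +
          (2 * ((a₁ + d₁) + (2 * (d : ℝ) + d₁) * c₉) + (2 * (d : ℝ) + d₁) * C₀ * κφ) + κE) *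
          bsum (fun b => (((sh b).fat : ℕ) : ℝ) + 1) G + Ξ) *
        (((L : ℝ) ^ d) * Real.exp μE) ^ partnerAges (PEv.step ∘ sh) G :=
  card_S_le_exp_pow_kit' sh zone ρ c₀ (nearP n L K lv tsz) (radP n L K lv tsz) (NZP' d L lv A) (MρP' d A)
    (nearP_mono n L K lv tsz)
    (fun t Z p u hp hu => by
      obtain ⟨htK, hsc, hrange⟩ := hzoneW t Z p u hp hu
      exact nearP_of_scale n L K lv tsz htK hsc hrange)
    (fun u t s r => card_nearP_le n L K lv tsz hL hA u t s r) (by positivity) (fun r => MρP'_nonneg A r)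
    (fun r t s => NZP'_le hlv hL A r t s) hθ0 hθ1 hB hM hγ hκM hDt hCh hlawM
    (MρP_placed_le_exp sh lv tsz zone ρ c₀ ha hd hAexp hC₀ hc₉ φ hφ0 G hlawR hΦ) hENT z

end Placed

end

end Summit.QuantumFields.BalabanUV.T4Continuum.HistoryJoinsPlacedEndConcave
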